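import Literature.AlgebraicGeometry.Motives.JacobianGaloisCoverNormAdjointIff
import Literature.AlgebraicGeometry.Motives.AbelianVarietyDegree
import Literature.AlgebraicGeometry.Motives.AbelianVarietySubvarietyOfFullDimension
import Literature.AlgebraicGeometry.Motives.CartierDivisorEffective
import HarnessLib

/-!
# Principal Riemann theta divisors are transported along isomorphisms of curves; hence
# (Aut-invariance of the canonical pairing) ⟸ (Θ-uniq), and (F-P2) ⟺ (C) ∧ (Θ-uniq)

Layer `Literature/AlgebraicGeometry/Motives`, namespaces `….Motives.AbelianVariety` (§1), `….Motives.Jacobian` (§2–§4).  KERNEL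
ONLY (theorems; no definition, no named fact, no instance, no `sorry`).  Sequel of ★ `Motives/JacobianGaloisCoverNormAdjointIff`.

## The mathematics

For an isomorphism of curves `e : X ⥲ Y` with Jacobians `𝒥X`, `𝒥Y`, the norm `Nm_e : J_X ⥲ J_Y` is an isomorphism of
abelian varieties (★ `Jacobian.isIso_pushforward_hom`) with `Nm_e ∘ α_P = α_{e P} ∘ e` (★ `abelJacobi_comp_pushforward`), hence
`Nm_e(W̃_r(P)) = W̃_r(e P)` on the Brill–Noether loci `W̃_r = \overline{α_{rP}(C^r)}` and `Nm_e ∘ t_x = t_{Nm_e x} ∘ Nm_e`.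
Consequently the pull-back `(Nm_e)^*Θ` of a RIEMANN THETA DIVISOR `Θ` of `J_Y` (effective, support a translate of
`W̃_{g−1}`) is a Riemann theta divisor of `J_X` (§2), and the pull-back of a PRINCIPAL polarisation divisor along any
isomorphism of abelian varieties is principal (§1: `K(u^*Θ) = u⁻¹ K(Θ)`, ampleness pulls back).  So, for ONE curve `X` and
`e ∈ Aut X`: `ē^{Θ}(Nm_e P, Nm_e Q) = ē^{(Nm_e)^*Θ}(P, Q)` (★ `weilPairingLevel_pullback`) `= ē^{Θ}(P, Q)` as soon as
(Θ-uniq) «two principal Riemann theta divisors of one Jacobian have the same level pairings» holds (§3) — statement (D) of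
★ `galoisCover_pullback_isWeilPairingAdjoint_norm_iff` follows from (Θ-uniq), and since (Θ-uniq) is itself the `Δ = 1`
content of (F-P2) (★ `Jacobian.weilPairingLevel_eq_of_isRiemannThetaDivisor`):

**(F-P2) ⟺ (C) ∧ (Θ-uniq)** (§4), (C) = «`ē^{Θ_X}(p^*P, p^*Q) = ē^{Θ_Y}(P, Q)^{|Δ|}`» ([BirkenhakeLange2004] Lemma 12.3.1 on
torsion points) and (Θ-uniq) = [Lange2023AbelianVarietiesComplex] §4.1.2 Prop. 4.1.2 with Cor. 4.2.4 (`W̃_{g−1} = t_x^*Θ`): the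
residual classical content of VI-8 is ONE cover statement and ONE single-Jacobian statement.

## What is proved
§1 `AbelianVariety.mem_KTheta_pullback_iff_of_isIso` (`P ∈ K(u^*Θ) ↔ uP ∈ K(Θ)` along an isomorphism `u`, any field),
`IsPrincipalPolarizationDivisor.pullback_of_isIso`; §2 `Jacobian.abelSum_comp_pushforward` (`α_{rP} ≫ Nm_f = f^r ≫ α_{r f(P)}`),
`image_brillNoetherLocus_of_iso` (`Nm_e(W̃_r(P)) = W̃_r(eP)`), **`IsRiemannThetaDivisor.pullback_of_iso`**; §3
**`weilPairingLevel_pushforward_aut_eq_of_thetaUniq`** ((D) at `X` from (Θ-uniq) at `X`); §4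
**`galoisCover_pullback_isWeilPairingAdjoint_norm_iff_thetaUniq`** ((F-P2) ⟺ (C) ∧ (Θ-uniq)).  Use (cell `hodgecm-mathlib`,
D-0151; crux HLiu418 = stmt-HodgeConjecture-24832, `stub_RosH` road (P), interface row VI-8): COUNT-NEUTRAL structure of the
classical binder; nothing here proves (C) or (Θ-uniq).  HC_CM is proved only modulo the 7 printed citations until rung 0
closes; this file moves no book by itself.

## References
* [Lange2023AbelianVarietiesComplex] H. Lange, *Abelian Varieties over the Complex Numbers* (2023), §4.1.2 Prop. 4.1.2, §4.2.1
  Lemma 4.2.1, Cor. 4.2.4, §4.5.2 (the norm map `N_f`), §2.1.1; [Milne1986JacobianVarieties] J. S. Milne, *Jacobian Varieties*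
  (1986), §5, §6 Prop. 6.4, Thm. 6.6; [BirkenhakeLange2004] C. Birkenhake, H. Lange, *Complex Abelian Varieties* (2004), §12.3
  Lemma 12.3.1; [LangeRodriguez2022] H. Lange, R. E. Rodríguez, *Decomposition of Jacobians by Prym Varieties* (2022), (3.3),
  Prop. 3.5.1; [MumfordAV1970] D. Mumford, *Abelian Varieties* (1970), §6 (`K(L)`), §20 property (3) of `e_n`.
-/

set_option autoImplicit false

noncomputable section

open CategoryTheory AlgebraicGeometry

universe u

namespace Literature.AlgebraicGeometry.Motives

namespace AbelianVariety

/-! ## §1 Principal polarisation divisors pull back along isomorphisms of abelian varieties -/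

variable {K : Type u} [Field K] {A B : AbelianVariety K}

/-- The underlying scheme morphism of an isomorphism of abelian varieties is dominant. [folklore] -/
private theorem isDominant_toSchemeHom_of_isIso (u : A ⟶ B) [IsIso u] : IsDominant (Hom.toSchemeHom u) := by
  haveI := isIso_toSchemeHom_of_isIso u
  infer_instance

/-- `u⁻¹ (u P) = P` on rational points for an isomorphism `u`. [folklore] -/
private theorem map_inv_map_of_isIso (u : A ⟶ B) [IsIso u] (P : A.Points K) :
    AlgPoints.map (inv u).hom.hom.hom (AlgPoints.map u.hom.hom.hom P) = P := by
  rw [← map_hom_comp_apply, IsIso.hom_inv_id, AlgPoints.map_apply]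
  exact Category.comp_id _

/-- `u (u⁻¹ Q) = Q` on rational points for an isomorphism `u`. [folklore] -/
private theorem map_map_inv_of_isIso (u : A ⟶ B) [IsIso u] (Q : B.Points K) :
    AlgPoints.map u.hom.hom.hom (AlgPoints.map (inv u).hom.hom.hom Q) = Q := by
  rw [← map_hom_comp_apply, IsIso.inv_hom_id, AlgPoints.map_apply]
  exact Category.comp_id _

/-- `g^* 0` is the zero divisor (local equations `g^♯ 1 = 1`). [folklore] -/
private theorem zero_pullback_sameDivisor {X Y : Scheme.{u}} [IsIntegral X] [IsIntegral Y] (g : Y ⟶ X) [IsDominant g] :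
    ((0 : CartierDivisor X).pullback g).SameDivisor 0 := fun i j y hi hj => by
  change RatFn.IsUnitAt y (RatFn.functionFieldMap g 1 / 1)
  rw [map_one, div_one]
  exact RatFn.isUnitAt_one

/-- **`K(u^*Θ) = u⁻¹ K(Θ)` for an isomorphism `u : A ⥲ B`**: `P ∈ K(u^*Θ)` iff `u P ∈ K(Θ)`, since
`D_P(u^*Θ) = u^* D_{uP}(Θ)` (★ `weilDiv_pullback_sameDivisor`) and `u^*` detects linear equivalence to `0` (pull back along
`u⁻¹`).  Mumford §6: `K(L)` for `L = 𝒪(Θ)`, functorial under isomorphisms. [cite: MumfordAV1970, §6 Definition (p. 60) and §8] -/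
theorem mem_KTheta_pullback_iff_of_isIso (u : A ⟶ B) [IsIso u] [IsDominant (Hom.toSchemeHom u)]
    (Θ : CartierDivisor B.X.left) (P : A.Points K) :
    P ∈ A.KTheta (Θ.pullback (Hom.toSchemeHom u)) ↔ AlgPoints.map u.hom.hom.hom P ∈ B.KTheta Θ := by
  haveI : IsDominant (Hom.toSchemeHom (inv u)) := isDominant_toSchemeHom_of_isIso (inv u)
  have hS := weilDiv_pullback_sameDivisor u Θ P
  -- pulling back along `u⁻¹ ≫ u = 𝟙` is the identity, up to `SameDivisor`
  have hcomp : Hom.toSchemeHom (inv u) ≫ Hom.toSchemeHom u = 𝟙 B.X.left := by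
    change Hom.toSchemeHom (inv u ≫ u) = _; rw [IsIso.inv_hom_id]; rfl
  have hback : ∀ D : CartierDivisor B.X.left,
      ((D.pullback (Hom.toSchemeHom u)).pullback (Hom.toSchemeHom (inv u))).SameDivisor D := fun D =>
    ((CartierDivisor.pullback_pullback_sameDivisor (D := D) (g := Hom.toSchemeHom u)
        (g' := Hom.toSchemeHom (inv u))).trans
      (CartierDivisor.pullback_congr_sameDivisor (D := D) hcomp)).trans (CartierDivisor.pullback_id_sameDivisor (D := D))
  rw [mem_KTheta_iff, mem_KTheta_iff]
  constructor
  · intro h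
    -- `u^* D_{uP} ∼ 0`; pull back along `u⁻¹`
    have h1 : ((B.weilDiv Θ (AlgPoints.map u.hom.hom.hom P)).pullback (Hom.toSchemeHom u)).LinEquiv 0 :=
      hS.symm.linEquiv.trans h
    have h2 := h1.pullback (Hom.toSchemeHom (inv u))
    exact ((hback _).symm.linEquiv.trans h2).trans (zero_pullback_sameDivisor (Hom.toSchemeHom (inv u))).linEquiv
  · intro h
    have h1 : ((B.weilDiv Θ (AlgPoints.map u.hom.hom.hom P)).pullback (Hom.toSchemeHom u)).LinEquiv
        ((0 : CartierDivisor B.X.left).pullback (Hom.toSchemeHom u)) := h.pullback (Hom.toSchemeHom u)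
    exact (hS.linEquiv.trans h1).trans (zero_pullback_sameDivisor (Hom.toSchemeHom u)).linEquiv

/-- **`K(u^*Θ) = ⊥` if `K(Θ) = ⊥`** along an isomorphism `u : A ⥲ B`. [cite: MumfordAV1970, §6 Definition (p. 60) and §8] -/
theorem KTheta_pullback_eq_bot_of_isIso (u : A ⟶ B) [IsIso u] [IsDominant (Hom.toSchemeHom u)]
    {Θ : CartierDivisor B.X.left} (h : B.KTheta Θ = ⊥) : A.KTheta (Θ.pullback (Hom.toSchemeHom u)) = ⊥ := by
  refine (Subgroup.eq_bot_iff_forall _).2 fun P hP => ?_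
  have h1 := (mem_KTheta_pullback_iff_of_isIso u Θ P).1 hP
  rw [h, Subgroup.mem_bot] at h1
  rw [← map_inv_map_of_isIso u P, h1, AlgPoints.map_apply]
  exact MonObj.one_comp _

/-- **A principal polarisation divisor pulls back to a principal polarisation divisor along an isomorphism of abelian
varieties** (`u^*Θ` is ample — an isomorphism is affine and dominant, ★ `CartierDivisor.IsAmple.pullback` — and
`K(u^*Θ) = u⁻¹ K(Θ) = 0`).  Lange §2.1.1: the type of a polarisation is an isomorphism invariant.
[cite: Lange2023AbelianVarietiesComplex, §2.1.1 (p. 68) and §1.4.2 Prop. 1.4.7] [cite: MumfordAV1970, §6 Definition (p. 60) and §8] -/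
theorem IsPrincipalPolarizationDivisor.pullback_of_isIso (u : A ⟶ B) [IsIso u] [IsDominant (Hom.toSchemeHom u)]
    {Θ : CartierDivisor B.X.left} (h : B.IsPrincipalPolarizationDivisor Θ) :
    A.IsPrincipalPolarizationDivisor (Θ.pullback (Hom.toSchemeHom u)) := by
  haveI := isIso_toSchemeHom_of_isIso u
  exact ⟨h.isAmple.pullback (Hom.toSchemeHom u), KTheta_pullback_eq_bot_of_isIso u h.KTheta_eq_bot⟩

end AbelianVariety

namespace Jacobian

open Literature.AlgebraicGeometry.RelativeSpec
open scoped MonObj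

variable {k : Type u} [Field k] {C C' : SchemeOver k}

/-! ## §2 Abel sums, Brill–Noether loci and Riemann theta divisors along isomorphisms of curves -/

/-- The induced map `f^r : C^r → C'^r` on fibre powers (`projᵢ ∘ f^r = f ∘ projᵢ`), written with the tree's `liftOver`.
[cite: Milne1986JacobianVarieties, §5 (the maps f^r : C^r → J)] -/
theorem liftOver_proj_comp_projOver (f : C ⟶ C') (r : ℕ) (i : Fin r) :
    liftOver C'.hom r (fun j => (projOver C.hom r j : powOverObj C.hom r ⟶ C) ≫ f) ≫ projOver C'.hom r i =
      (projOver C.hom r i : powOverObj C.hom r ⟶ C) ≫ f :=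
  liftOver_projOver _ _ _ _

/-- `f^r ≫ g^r = 𝟙` when `f ≫ g = 𝟙`: the induced map of an isomorphism of curves on fibre powers is an isomorphism (in
particular surjective on points). [cite: Milne1986JacobianVarieties, §5 (the maps f^r : C^r → J)] -/
theorem liftOver_comp_liftOver_eq_id (f : C ⟶ C') (g : C' ⟶ C) (hfg : f ≫ g = 𝟙 C) (r : ℕ) :
    liftOver C'.hom r (fun j => (projOver C.hom r j : powOverObj C.hom r ⟶ C) ≫ f) ≫
        liftOver C.hom r (fun j => (projOver C'.hom r j : powOverObj C'.hom r ⟶ C') ≫ g) = 𝟙 _ := by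
  apply hom_ext_projOver
  intro i
  rw [Category.assoc, liftOver_projOver, ← Category.assoc, liftOver_projOver, Category.id_comp, Category.assoc]
  -- `proj_i ≫ f ≫ g = proj_i` (stated afresh so that the objects are `C`, `C'`, `C`)
  exact (congrArg (fun h => (projOver C.hom r i : powOverObj C.hom r ⟶ C) ≫ h) hfg).trans (Category.comp_id _)

/-- Post-composition of a finite product of `A`-valued points with a HOMOMORPHISM of group schemes distributes
(`(∏ fᵢ) ≫ u = ∏ (fᵢ ≫ u)`; Mathlib `MonObj.mul_comp` iterated). [cite: MumfordAV1970, §4 (Cor. 1 of the rigidity lemma)] -/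
theorem prod_comp_hom {T : SchemeOver k} {A B : AbelianVariety k} (u : A ⟶ B) {J : Type*} (s : Finset J)
    (g : J → (T ⟶ A.X)) : (∏ i ∈ s, g i) ≫ u.hom.hom.hom = ∏ i ∈ s, (g i ≫ u.hom.hom.hom) := by
  classical
  induction s using Finset.induction_on with
  | empty => rw [Finset.prod_empty, Finset.prod_empty, MonObj.one_comp]
  | insert a s ha ih => rw [Finset.prod_insert ha, Finset.prod_insert ha, MonObj.mul_comp, ih]

/-- Pre-composition distributes over a finite product of points (`v ≫ ∏ gᵢ = ∏ (v ≫ gᵢ)`; Mathlib `MonObj.comp_mul`).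
[cite: MumfordAV1970, §4 (Cor. 1 of the rigidity lemma)] -/
theorem comp_prod {T T' : SchemeOver k} {A : AbelianVariety k} (v : T' ⟶ T) {J : Type*} (s : Finset J)
    (g : J → (T ⟶ A.X)) : v ≫ (∏ i ∈ s, g i) = ∏ i ∈ s, (v ≫ g i) := by
  classical
  induction s using Finset.induction_on with
  | empty => rw [Finset.prod_empty, Finset.prod_empty, MonObj.comp_one]
  | insert a s ha ih => rw [Finset.prod_insert ha, Finset.prod_insert ha, MonObj.comp_mul, ih]

/-- **`α_{rP} ≫ Nm_f = f^r ≫ α_{r f(P)}`**: the Abel sum maps commute with the norm map of any `f : C → C'`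
(Lange's square `N_f α_c = α_{f(c)} f`, ★ `abelJacobi_comp_pushforward`, summed over the `r` factors).
[cite: Lange2023AbelianVarietiesComplex, §4.5.2 (N_f ∘ α_c = α_{f(c)} ∘ f, p. 227)] [cite: Milne1986JacobianVarieties, §5 and §6 Prop. 6.4] -/
theorem abelSum_comp_pushforward (𝒥 : Jacobian C) (𝒥' : Jacobian C') (f : C ⟶ C') (P : AlgPoints C k) (r : ℕ) :
    𝒥.abelSum P r ≫ (𝒥.pushforward 𝒥' f).hom.hom.hom =
      liftOver C'.hom r (fun j => (projOver C.hom r j : powOverObj C.hom r ⟶ C) ≫ f) ≫ 𝒥'.abelSum (P ≫ f) r := by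
  unfold abelSum
  rw [prod_comp_hom, comp_prod]
  refine Finset.prod_congr rfl fun i _ => ?_
  -- `proj_i ≫ α_P ≫ Nm_f = proj_i ≫ f ≫ α_{fP}` and `f^r ≫ proj_i ≫ α_{fP} = (proj_i ≫ f) ≫ α_{fP}` (objects `C`, `C'`)
  have h1 := congrArg (fun h => (projOver C.hom r i : powOverObj C.hom r ⟶ C) ≫ h) (𝒥.abelJacobi_comp_pushforward 𝒥' f P)
  have h2 : liftOver C'.hom r (fun j => (projOver C.hom r j : powOverObj C.hom r ⟶ C) ≫ f) ≫
      (projOver C'.hom r i : powOverObj C'.hom r ⟶ C') ≫ 𝒥'.abelJacobi (P ≫ f) =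
        ((projOver C.hom r i : powOverObj C.hom r ⟶ C) ≫ f) ≫ 𝒥'.abelJacobi (P ≫ f) := by
    rw [← Category.assoc, liftOver_projOver]
    rfl
  rw [Category.assoc]
  exact h1.trans ((Category.assoc _ _ _).symm.trans h2.symm)

/-- **`Nm_e(W̃_r(P)) = W̃_r(e P)`** for an isomorphism of curves `e : C ⥲ C'`: the norm map (an isomorphism of the
Jacobians, hence a closed continuous bijection) carries the Brill–Noether locus `W̃_r(P) = \overline{α_{rP}(C^r)}` onto
`W̃_r(eP)` (`α_{rP} ≫ Nm_e = e^r ≫ α_{r eP}` with `e^r` surjective). [cite: Lange2023AbelianVarietiesComplex, §4.2.1 Lemma 4.2.1 and §4.5.2] [cite: Milne1986JacobianVarieties, §5 and §6 Prop. 6.4] -/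
theorem image_brillNoetherLocus_of_iso (𝒥 : Jacobian C) (𝒥' : Jacobian C') (e : C ≅ C') (P : AlgPoints C k) (r : ℕ) :
    (AbelianVariety.Hom.toSchemeHom (𝒥.pushforward 𝒥' e.hom)).base '' 𝒥.brillNoetherLocus P r =
      𝒥'.brillNoetherLocus (P ≫ e.hom) r := by
  set u := 𝒥.pushforward 𝒥' e.hom with hu
  set v := 𝒥'.pushforward 𝒥 e.inv with hv
  have huv : u ≫ v = 𝟙 _ := by rw [hu, hv, ← pushforward_comp, e.hom_inv_id, pushforward_id]
  have hvu : v ≫ u = 𝟙 _ := by rw [hu, hv, ← pushforward_comp, e.inv_hom_id, pushforward_id]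
  -- `u` on points is a bijection with inverse `v`; images under `u` are preimages under `v`
  have h1 : Function.LeftInverse (AbelianVariety.Hom.toSchemeHom v).base (AbelianVariety.Hom.toSchemeHom u).base :=
    fun x => by
      change (AbelianVariety.Hom.toSchemeHom u ≫ AbelianVariety.Hom.toSchemeHom v) x = x
      rw [show AbelianVariety.Hom.toSchemeHom u ≫ AbelianVariety.Hom.toSchemeHom v =
        AbelianVariety.Hom.toSchemeHom (u ≫ v) from rfl, huv]
      rfl
  have h2 : Function.RightInverse (AbelianVariety.Hom.toSchemeHom v).base (AbelianVariety.Hom.toSchemeHom u).base :=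
    fun y => by
      change (AbelianVariety.Hom.toSchemeHom v ≫ AbelianVariety.Hom.toSchemeHom u) y = y
      rw [show AbelianVariety.Hom.toSchemeHom v ≫ AbelianVariety.Hom.toSchemeHom u =
        AbelianVariety.Hom.toSchemeHom (v ≫ u) from rfl, hvu]
      rfl
  have himpre : ∀ S : Set 𝒥.J.X.left,
      (AbelianVariety.Hom.toSchemeHom u).base '' S = (AbelianVariety.Hom.toSchemeHom v).base ⁻¹' S := fun S => by
    rw [Set.image_eq_preimage_of_inverse h1 h2]
  -- image of the closure = closure of the image (closed continuous bijection)
  have hcl : ∀ S : Set 𝒥.J.X.left, (AbelianVariety.Hom.toSchemeHom u).base '' closure S =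
      closure ((AbelianVariety.Hom.toSchemeHom u).base '' S) := fun S => by
    apply Set.Subset.antisymm (image_closure_subset_closure_image (AbelianVariety.Hom.toSchemeHom u).continuous)
    refine closure_minimal (Set.image_mono subset_closure) ?_
    rw [himpre]
    exact IsClosed.preimage (AbelianVariety.Hom.toSchemeHom v).continuous isClosed_closure
  -- image of the range of the Abel sum map
  unfold brillNoetherLocus
  rw [hcl, ← Set.range_comp]
  congr 1
  have hcomp : (AbelianVariety.Hom.toSchemeHom u).base ∘ (𝒥.abelSum P r).left.base =
      (𝒥'.abelSum (P ≫ e.hom) r).left.base ∘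
        (liftOver C'.hom r (fun j => (projOver C.hom r j : powOverObj C.hom r ⟶ C) ≫ e.hom)).left.base := by
    funext z
    change ((𝒥.abelSum P r).left ≫ AbelianVariety.Hom.toSchemeHom u) z = _
    rw [show (𝒥.abelSum P r).left ≫ AbelianVariety.Hom.toSchemeHom u = (𝒥.abelSum P r ≫ u.hom.hom.hom).left from rfl,
      hu, abelSum_comp_pushforward, Over.comp_left, Scheme.Hom.comp_apply]
    rfl
  rw [hcomp, Set.range_comp]
  -- `e^r` is surjective on points (it has the two-sided inverse `(e⁻¹)^r`)
  have hsurj : Function.Surjective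
      (liftOver C'.hom r (fun j => (projOver C.hom r j : powOverObj C.hom r ⟶ C) ≫ e.hom)).left.base := by
    intro z
    refine ⟨(liftOver C.hom r (fun j => (projOver C'.hom r j : powOverObj C'.hom r ⟶ C') ≫ e.inv)).left.base z, ?_⟩
    change ((liftOver C.hom r (fun j => (projOver C'.hom r j : powOverObj C'.hom r ⟶ C') ≫ e.inv)).left ≫
      (liftOver C'.hom r (fun j => (projOver C.hom r j : powOverObj C.hom r ⟶ C) ≫ e.hom)).left) z = z
    rw [← Over.comp_left, liftOver_comp_liftOver_eq_id e.inv e.hom e.inv_hom_id r]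
    rfl
  rw [hsurj.range_eq, Set.image_univ]

/-- `Nm_e ∘ t_x = t_{Nm_e x} ∘ Nm_e` on underlying spaces, image form: `Nm_e(t_x(S)) = t_{Nm_e x}(Nm_e(S))`.
[cite: MumfordAV1970, §4 (Cor. 1 of the rigidity lemma)] -/
theorem image_image_translation {A B : AbelianVariety k} (u : A ⟶ B) (x : A.Points k) (S : Set A.X.left) :
    (AbelianVariety.Hom.toSchemeHom u).base '' ((A.translation x).left.base '' S) =
      (B.translation (AlgPoints.map u.hom.hom.hom x)).left.base '' ((AbelianVariety.Hom.toSchemeHom u).base '' S) := by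
  rw [Set.image_image, Set.image_image]
  refine Set.image_congr' fun z => ?_
  change ((A.translation x).left ≫ AbelianVariety.Hom.toSchemeHom u) z =
    (AbelianVariety.Hom.toSchemeHom u ≫ (B.translation (AlgPoints.map u.hom.hom.hom x)).left) z
  rw [AbelianVariety.translation_left_comp_toSchemeHom]

/-- **A Riemann theta divisor pulls back to a Riemann theta divisor along the norm of an isomorphism of curves.**
For `e : X ⥲ Y`, Jacobians `𝒥X`, `𝒥Y` and a Riemann theta divisor `Θ` of `J_Y` (effective, support `t_x(W̃_{g−1}(P))`), the
pull-back `(Nm_e)^*Θ` is effective with support `Nm_e⁻¹(t_x W̃_{g−1}(P)) = t_{x′}(W̃_{g−1}(e⁻¹ P))`, `x′ = Nm_{e⁻¹} x`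
(`Nm_{e⁻¹} = Nm_e⁻¹`; `dim J_X = dim J_Y`).  Print: «if `P` is replaced by a second point, `Θ` is replaced by a translate»
and theta divisors are transported by isomorphisms of polarised Jacobians. [cite: Milne1986JacobianVarieties, §6 (Θ = W^{g-1}, before Thm. 6.6) and Prop. 6.4]
[cite: Lange2023AbelianVarietiesComplex, §4.2.1 Cor. 4.2.4 and §4.5.2] -/
theorem IsRiemannThetaDivisor.pullback_of_iso {X Y : SchemeOver k} (𝒥X : Jacobian X) (𝒥Y : Jacobian Y) (e : X ≅ Y)
    [IsDominant (AbelianVariety.Hom.toSchemeHom (𝒥X.pushforward 𝒥Y e.hom))]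
    {Θ : CartierDivisor 𝒥Y.J.X.left} (h : 𝒥Y.IsRiemannThetaDivisor Θ) :
    𝒥X.IsRiemannThetaDivisor (Θ.pullback (AbelianVariety.Hom.toSchemeHom (𝒥X.pushforward 𝒥Y e.hom))) := by
  set u := 𝒥X.pushforward 𝒥Y e.hom with hu
  set v := 𝒥Y.pushforward 𝒥X e.inv with hv
  have huv : u ≫ v = 𝟙 _ := by rw [hu, hv, ← pushforward_comp, e.hom_inv_id, pushforward_id]
  have hvu : v ≫ u = 𝟙 _ := by rw [hu, hv, ← pushforward_comp, e.inv_hom_id, pushforward_id]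
  haveI : IsIso u := ⟨v, huv, hvu⟩
  refine ⟨h.isEffective.pullback _, ?_⟩
  obtain ⟨P, x, hsupp⟩ := h.exists_support_eq
  refine ⟨P ≫ e.inv, AlgPoints.map v.hom.hom.hom x, ?_⟩
  -- the support of the pull-back is the preimage of the support
  have hsec : Θ.IsSection 1 := h.isEffective.isSection_one
  have hpre := CartierDivisor.preimage_nonvanishing (AbelianVariety.Hom.toSchemeHom u) hsec
  rw [map_one] at hpre
  rw [← hpre, ← Set.preimage_compl, hsupp]
  -- preimage under `u` = image under `v = u⁻¹`
  have h1 : Function.LeftInverse (AbelianVariety.Hom.toSchemeHom u).base (AbelianVariety.Hom.toSchemeHom v).base :=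
    fun y => by
      change (AbelianVariety.Hom.toSchemeHom v ≫ AbelianVariety.Hom.toSchemeHom u) y = y
      rw [show AbelianVariety.Hom.toSchemeHom v ≫ AbelianVariety.Hom.toSchemeHom u =
        AbelianVariety.Hom.toSchemeHom (v ≫ u) from rfl, hvu]
      rfl
  have h2 : Function.RightInverse (AbelianVariety.Hom.toSchemeHom u).base (AbelianVariety.Hom.toSchemeHom v).base :=
    fun y => by
      change (AbelianVariety.Hom.toSchemeHom u ≫ AbelianVariety.Hom.toSchemeHom v) y = y
      rw [show AbelianVariety.Hom.toSchemeHom u ≫ AbelianVariety.Hom.toSchemeHom v =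
        AbelianVariety.Hom.toSchemeHom (u ≫ v) from rfl, huv]
      rfl
  have himg := image_brillNoetherLocus_of_iso 𝒥Y 𝒥X e.symm P (𝒥Y.J.dim - 1)
  rw [Iso.symm_hom] at himg
  rw [← Set.image_eq_preimage_of_inverse h1 h2, image_image_translation, hv, himg]
  -- the dimensions of the two Jacobians agree (`Nm_e` is an isomorphism, hence an isogeny)
  have hdim : 𝒥Y.J.dim = 𝒥X.J.dim := by
    haveI : IsIso v := ⟨u, hvu, huv⟩
    haveI := AbelianVariety.isIso_toSchemeHom_of_isIso v
    exact AbelianVariety.dim_eq_of_isIsogeny (f := v) ⟨inferInstance, inferInstance⟩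
  rw [hdim]

/-! ## §3 (D) ⟸ (Θ-uniq): Aut-invariance of the canonical pairing from its independence of the theta divisor -/

/-- **(D) from (Θ-uniq).**  For a Jacobian `𝒥` of a curve `X` over a field `k`, `e ∈ Aut X` and a divisor `Θ` on `J` which is a
Riemann theta divisor and a principal polarisation divisor: IF any two such divisors of `J` have the same level-`N` pairing
((Θ-uniq) at `𝒥`, [Lange2023AbelianVarietiesComplex] Prop. 4.1.2 / Cor. 4.2.4), THEN `ē_N^{Θ}(Nm_e P, Nm_e Q) = ē_N^{Θ}(P, Q)` —
indeed `ē^{Θ}(Nm_e P, Nm_e Q) = ē^{(Nm_e)^*Θ}(P, Q)` (★ `weilPairingLevel_pullback`) and `(Nm_e)^*Θ` is again a principal Riemann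
theta divisor (§1, §2). [cite: Lange2023AbelianVarietiesComplex, §4.1.2 Prop. 4.1.2 and §4.2.1 Cor. 4.2.4] [cite: MumfordAV1970, §20 (property (3) of e_n, p. 186)] -/
theorem weilPairingLevel_pushforward_aut_eq_of_thetaUniq {X : SchemeOver k} (𝒥 : Jacobian X) (e : X ≅ X)
    {Θ : CartierDivisor 𝒥.J.X.left} (h1 : 𝒥.IsRiemannThetaDivisor Θ) (h2 : 𝒥.J.IsPrincipalPolarizationDivisor Θ)
    (N : ℕ) [IsDominant (AbelianVariety.Hom.toSchemeHom ((N : ℤ) • 𝟙 𝒥.J))]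
    (huniq : ∀ (Θ₁ Θ₂ : CartierDivisor 𝒥.J.X.left),
      𝒥.IsRiemannThetaDivisor Θ₁ → 𝒥.J.IsPrincipalPolarizationDivisor Θ₁ →
      𝒥.IsRiemannThetaDivisor Θ₂ → 𝒥.J.IsPrincipalPolarizationDivisor Θ₂ →
      ∀ P Q : 𝒥.J.torsionPoints k N, 𝒥.J.weilPairingLevel Θ₁ P Q = 𝒥.J.weilPairingLevel Θ₂ P Q)
    (P Q : 𝒥.J.torsionPoints k N) :
    𝒥.J.weilPairingLevel Θ
        ⟨AlgPoints.map (𝒥.pushforward 𝒥 e.hom).hom.hom.hom P.1,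
          AbelianVariety.map_mem_torsionPoints (𝒥.pushforward 𝒥 e.hom) P.2⟩
        ⟨AlgPoints.map (𝒥.pushforward 𝒥 e.hom).hom.hom.hom Q.1,
          AbelianVariety.map_mem_torsionPoints (𝒥.pushforward 𝒥 e.hom) Q.2⟩ =
      𝒥.J.weilPairingLevel Θ P Q := by
  have huv : 𝒥.pushforward 𝒥 e.hom ≫ 𝒥.pushforward 𝒥 e.inv = 𝟙 _ := by
    rw [← pushforward_comp, e.hom_inv_id, pushforward_id]
  have hvu : 𝒥.pushforward 𝒥 e.inv ≫ 𝒥.pushforward 𝒥 e.hom = 𝟙 _ := by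
    rw [← pushforward_comp, e.inv_hom_id, pushforward_id]
  haveI : IsIso (𝒥.pushforward 𝒥 e.hom) := ⟨_, huv, hvu⟩
  haveI : IsDominant (AbelianVariety.Hom.toSchemeHom (𝒥.pushforward 𝒥 e.hom)) :=
    AbelianVariety.isDominant_toSchemeHom_of_isIso _
  rw [← AbelianVariety.weilPairingLevel_pullback (𝒥.pushforward 𝒥 e.hom) Θ P Q]
  exact huniq _ _ (IsRiemannThetaDivisor.pullback_of_iso 𝒥 𝒥 e h1)
    (AbelianVariety.IsPrincipalPolarizationDivisor.pullback_of_isIso _ h2) h1 h2 P Q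

/-! ## §4 (F-P2) ⟺ (C) ∧ (Θ-uniq) -/

/-- **`Jacobian.galoisCover_pullback_isWeilPairingAdjoint_norm ↔ (C) ∧ (Θ-uniq)`.**  The named fact (F-P2) «`p^*` is the
Weil-pairing adjoint of `Nm_p` for the canonical principal polarisations of a Galois cover of complex curves»
([LangeRodriguez2022] (3.3), [Lange2023AbelianVarietiesComplex] (4.9)) is EQUIVALENT to the conjunction of the cover statement
(C) «`ē_N^{Θ_X}(p^*P, p^*Q) = ē_N^{Θ_Y}(P, Q)^{|Δ|}`» ([BirkenhakeLange2004] Lemma 12.3.1 on torsion points; binders of the fact)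
and the single-Jacobian statement (Θ-uniq) «two Riemann theta divisors of one complex Jacobian (`dim ≥ 1`) defining PRINCIPAL
polarisations have the same level pairings» ([Lange2023AbelianVarietiesComplex] Prop. 4.1.2 with Cor. 4.2.4).  (⇒): ★
`galoisCover_pullback_isWeilPairingAdjoint_norm_iff` and ★ `weilPairingLevel_eq_of_isRiemannThetaDivisor`; (⇐): (D) from (Θ-uniq)
(§3) and ★ `galoisCover_pullback_isWeilPairingAdjoint_norm_iff`.
[cite: LangeRodriguez2022, §3.2.1 eq. (3.3) (pp. 46–47); §3.5.1 Prop. 3.5.1 (p. 65)] [cite: BirkenhakeLange2004, §12.3 Lemma 12.3.1 (p. 372)]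
[cite: Lange2023AbelianVarietiesComplex, §4.1.2 Prop. 4.1.2 and §4.2.1 Cor. 4.2.4] -/
theorem galoisCover_pullback_isWeilPairingAdjoint_norm_iff_thetaUniq :
    galoisCover_pullback_isWeilPairingAdjoint_norm ↔
      ((∀ (X Y : SchemeOver ℂ), IsSmoothProjective 1 X → IsSmoothProjective 1 Y →
        ∀ (𝒥X : Jacobian X) (𝒥Y : Jacobian Y), 1 ≤ 𝒥Y.J.dim →
        ∀ (Δ : Type) [Group Δ] [Fintype Δ] (act : Δ →* Aut X), Function.Injective act →
        ∀ (p : X ⟶ Y), IsSepQuotient (fun δ : Δ => act δ) p →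
        ∀ (ΘX : CartierDivisor 𝒥X.J.X.left) (ΘY : CartierDivisor 𝒥Y.J.X.left),
          𝒥X.IsRiemannThetaDivisor ΘX → 𝒥X.J.IsPrincipalPolarizationDivisor ΘX →
          𝒥Y.IsRiemannThetaDivisor ΘY → 𝒥Y.J.IsPrincipalPolarizationDivisor ΘY →
        ∀ (t : 𝒥Y.J ⟶ 𝒥X.J), 𝒥X.pushforward 𝒥Y p ≫ t = ∑ δ : Δ, 𝒥X.pushforward 𝒥X (act δ).hom →
        ∀ (N : ℕ) [IsDominant (AbelianVariety.Hom.toSchemeHom ((N : ℤ) • 𝟙 𝒥X.J))]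
          [IsDominant (AbelianVariety.Hom.toSchemeHom ((N : ℤ) • 𝟙 𝒥Y.J))]
          (P Q : 𝒥Y.J.torsionPoints ℂ N),
          𝒥X.J.weilPairingLevel ΘX ⟨AlgPoints.map t.hom.hom.hom P.1, AbelianVariety.map_mem_torsionPoints t P.2⟩
              ⟨AlgPoints.map t.hom.hom.hom Q.1, AbelianVariety.map_mem_torsionPoints t Q.2⟩ =
            𝒥Y.J.weilPairingLevel ΘY P Q ^ Fintype.card Δ) ∧
      (∀ (X : SchemeOver ℂ), IsSmoothProjective 1 X → ∀ (𝒥 : Jacobian X), 1 ≤ 𝒥.J.dim →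
        ∀ (Θ Θ' : CartierDivisor 𝒥.J.X.left),
          𝒥.IsRiemannThetaDivisor Θ → 𝒥.J.IsPrincipalPolarizationDivisor Θ →
          𝒥.IsRiemannThetaDivisor Θ' → 𝒥.J.IsPrincipalPolarizationDivisor Θ' →
        ∀ (N : ℕ) [IsDominant (AbelianVariety.Hom.toSchemeHom ((N : ℤ) • 𝟙 𝒥.J))] (P Q : 𝒥.J.torsionPoints ℂ N),
          𝒥.J.weilPairingLevel Θ P Q = 𝒥.J.weilPairingLevel Θ' P Q)) := by
  rw [galoisCover_pullback_isWeilPairingAdjoint_norm_iff]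
  constructor
  · rintro ⟨hC, hD⟩
    refine ⟨hC, fun X hX 𝒥 hdim Θ Θ' h1 h2 h3 h4 N _ P Q => ?_⟩
    exact weilPairingLevel_eq_of_isRiemannThetaDivisor (galoisCover_pullback_isWeilPairingAdjoint_norm_iff.2 ⟨hC, hD⟩)
      hX 𝒥 hdim h1 h2 h3 h4 N P Q
  · rintro ⟨hC, hU⟩
    refine ⟨hC, fun X hX 𝒥 hdim e Θ h1 h2 N _ P Q => ?_⟩
    exact weilPairingLevel_pushforward_aut_eq_of_thetaUniq 𝒥 e h1 h2 N
      (fun Θ₁ Θ₂ g1 g2 g3 g4 P' Q' => hU X hX 𝒥 hdim Θ₁ Θ₂ g1 g2 g3 g4 N P' Q') P Q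

end Jacobian

end Literature.AlgebraicGeometry.Motives

end
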